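import Literature.NumberTheory.Automorphic.LocalConstants
import Literature.NumberTheory.GaloisRepresentations.WeilDeligneRepProofs
import Literature.NumberTheory.GaloisRepresentations.WeilDeligneRepFrobSemisimpleProofs
import Literature.NumberTheory.GaloisRepresentations.LocalGaloisGroupProofs
import HarnessLib

/-!
# Route IrreducibilityBySelfDuality, crux `ReciprocityUpToIrreducibilityR` (stmt-Langlands-17925), line `Sketch`:
# vocabulary for stub S-17a-B (Henniart 2002 Thm 1.7 (a), Galois side) — strings of Weil–Deligne representations

Objects posited by the proof of the registered stub `stub_isEquivalent_of_finrank_invariants_tprod_eq`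
(D-0016 `<Route>Defs`-type file; NOTHING is asserted here — definitions and their unfolding lemmas only),
shared by the helper files `…RString*.lean` that prove Deligne's structure theorem for
Frobenius-semisimple Weil–Deligne representations and Henniart's reconstruction from `Hom`-dimensions.
All over the tree's carrier `Literature.NumberTheory.GaloisRepresentations.WeilDeligneRep`:

* `IsWStable r p`, `IsWIrreducible r H` — `W_F`-stable / `W_F`-irreducible subspaces of `r = (ρ, N)`;
* `strMap r d : (Fin d → V) →ₗ V`, `(y_j) ↦ Σ_j N^j y_j`, and `stringSpan r H d = H + N H + ⋯ + N^{d-1} H`;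
  `IsStringHead r H d` — `H` irreducible, `0 < d`, `N^d H = 0`, `N^{d-1}` injective on `H` (then
  `stringSpan r H d ≅ ρ_H ⊗ Sp(d)`, Deligne's indecomposable; Tate, Corvallis 1979, (4.1.5));
* `homWD τ σ ≤ (W →ₗ V)` — the space `Hom_WD(τ, σ)` of morphisms of Weil–Deligne representations
  (Deligne 1973 §8.4.1; the tree's `WeilDeligneRep.Hom` as a subspace), and `homWDIn τ σ U` — those with
  values in a subspace `U`;
* `twistRep ρ b` — the unramified twist `w ↦ ‖w‖^b ρ(w)`, `‖w‖ = q^{deg w}` (uses the DISCHARGED facts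
  `IsFrobPow.mul_holds/unique_holds` making `deg` a homomorphism); `IsoTw ρ b ρ'` — `ρ ⊗ ‖·‖^b ≅ ρ'`;
* `stringModel ρ hρ d` — the STANDARD STRING `ρ ⊗ Sp(d)` on `Fin d → H`: slot `j` carries `ρ ⊗ ‖·‖^j`,
  `N` shifts slot `j` to slot `j + 1` (Tate, Corvallis 1979, (4.1.4)–(4.1.5), with the tree's sign
  convention `ρ(w) N ρ(w)⁻¹ = q^{deg w} N`).

References: P. Deligne, *Les constantes des équations fonctionnelles des fonctions L*, Antwerp II, LNM 349
(1973), §8; J. Tate, *Number theoretic background*, Corvallis 1979, (4.1.2)–(4.1.6); G. Henniart, Bull. SMF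
130 (2002), §1.7 and §4.
-/

noncomputable section

set_option linter.dupNamespace false -- `Summit.Langlands.Langlands` is the mandated namespace

open Module
open Literature.NumberTheory.Automorphic Literature.NumberTheory.GaloisRepresentations
open Literature.NumberTheory.GaloisRepresentations.WeilGroup
open Literature.NumberTheory.GaloisRepresentations.IsNonarchimedeanLocalField

namespace Summit.Langlands.Langlands.Theorems.ReciprocityUpToIrreducibilityR

variable {F : Type} [Field F] [ValuativeRel F] [TopologicalSpace F] [IsNonarchimedeanLocalField F]

/-! ## Stable subspaces and strings inside a Weil–Deligne representation -/

section Ambient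

variable {V : Type*} [AddCommGroup V] [Module ℂ V]

/-- A subspace is **`W_F`-stable** for `r = (ρ, N)` if `ρ(w) p ≤ p` for all `w` (the first clause of
the tree's `WeilDeligneRep.IsSubrep`). [cite: TateCorvallis1979, (4.1.5)] -/
def IsWStable (r : WeilDeligneRep F ℂ V) (p : Submodule ℂ V) : Prop :=
  ∀ w : WeilGroup F, p ≤ p.comap (r.ρ w)

/-- A subspace is **`W_F`-irreducible** for `r`: non-zero, `W_F`-stable, and with no `W_F`-stable
subspace other than `⊥` and itself. [cite: TateCorvallis1979, (4.1.5)] -/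
def IsWIrreducible (r : WeilDeligneRep F ℂ V) (H : Submodule ℂ V) : Prop :=
  H ≠ ⊥ ∧ IsWStable r H ∧ ∀ q : Submodule ℂ V, q ≤ H → IsWStable r q → q = ⊥ ∨ q = H

/-- The **string map** `(y_j)_{j<d} ↦ Σ_j N^j y_j`. [cite: TateCorvallis1979, (4.1.5)] -/
def strMap (r : WeilDeligneRep F ℂ V) (d : ℕ) : (Fin d → V) →ₗ[ℂ] V :=
  ∑ j : Fin d, (r.N ^ (j : ℕ)) ∘ₗ LinearMap.proj j

/-- Unfolding of the string map. [cite: TateCorvallis1979, (4.1.5)] -/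
theorem strMap_apply (r : WeilDeligneRep F ℂ V) (d : ℕ) (y : Fin d → V) :
    strMap r d y = ∑ j : Fin d, (r.N ^ (j : ℕ)) (y j) := by
  simp [strMap, LinearMap.sum_apply]

/-- The **string** of length `d` with head `H`: `H + N H + ⋯ + N^{d-1} H`, the image of `H^d` under the
string map. [cite: TateCorvallis1979, (4.1.5)] -/
def stringSpan (r : WeilDeligneRep F ℂ V) (H : Submodule ℂ V) (d : ℕ) : Submodule ℂ V :=
  (Submodule.pi Set.univ (fun _ : Fin d => H)).map (strMap r d)

/-- Membership in a string: `x = Σ_{j<d} N^j y_j` with all `y_j ∈ H`. [cite: TateCorvallis1979, (4.1.5)] -/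
theorem mem_stringSpan_iff (r : WeilDeligneRep F ℂ V) {H : Submodule ℂ V} {d : ℕ} {x : V} :
    x ∈ stringSpan r H d ↔ ∃ y : Fin d → V, (∀ j, y j ∈ H) ∧ strMap r d y = x := by
  simp only [stringSpan, Submodule.mem_map, Submodule.mem_pi, Set.mem_univ, true_implies]

/-- `H` is the **head of a string of length `d`** in `r = (ρ, N)`: `H` is `W_F`-irreducible,
`0 < d`, `N^d H = 0` and `N^{d-1}` is injective on `H`.  Then `stringSpan r H d ≅ ρ_H ⊗ Sp(d)` is one
of Deligne's indecomposables. [cite: TateCorvallis1979, (4.1.5)] -/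
structure IsStringHead (r : WeilDeligneRep F ℂ V) (H : Submodule ℂ V) (d : ℕ) : Prop where
  /-- the head is `W_F`-irreducible -/
  irreducible : IsWIrreducible r H
  /-- strings have positive length -/
  pos : 0 < d
  /-- `N^d` kills the head -/
  le_ker : H ≤ LinearMap.ker (r.N ^ d)
  /-- `N^{d-1}` is injective on the head -/
  disjoint_ker : Disjoint H (LinearMap.ker (r.N ^ (d - 1)))

end Ambient

/-! ## Morphisms of Weil–Deligne representations as a vector space -/

section Hom

variable {W : Type*} [AddCommGroup W] [Module ℂ W] {V : Type*} [AddCommGroup V] [Module ℂ V]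

/-- **`Hom_WD(τ, σ)`**: the linear maps intertwining the `W_F`-actions and the monodromy operators (the
tree's `WeilDeligneRep.Hom`, as a subspace of `W →ₗ V`). [cite: Deligne1973Constantes, 8.5–8.6] -/
def homWD (τ : WeilDeligneRep F ℂ W) (σ : WeilDeligneRep F ℂ V) : Submodule ℂ (W →ₗ[ℂ] V) where
  carrier := {f | (∀ w : WeilGroup F, f ∘ₗ τ.ρ w = σ.ρ w ∘ₗ f) ∧ f ∘ₗ τ.N = σ.N ∘ₗ f}
  add_mem' := by
    rintro f g ⟨hf, hfN⟩ ⟨hg, hgN⟩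
    exact ⟨fun w => by rw [LinearMap.add_comp, LinearMap.comp_add, hf, hg],
      by rw [LinearMap.add_comp, LinearMap.comp_add, hfN, hgN]⟩
  zero_mem' := ⟨fun w => by rw [LinearMap.zero_comp, LinearMap.comp_zero],
    by rw [LinearMap.zero_comp, LinearMap.comp_zero]⟩
  smul_mem' := by
    rintro c f ⟨hf, hfN⟩
    exact ⟨fun w => by rw [LinearMap.smul_comp, LinearMap.comp_smul, hf],
      by rw [LinearMap.smul_comp, LinearMap.comp_smul, hfN]⟩

/-- Membership in `Hom_WD(τ, σ)`. [cite: Deligne1973Constantes, 8.5–8.6] -/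
theorem mem_homWD_iff {τ : WeilDeligneRep F ℂ W} {σ : WeilDeligneRep F ℂ V} {f : W →ₗ[ℂ] V} :
    f ∈ homWD τ σ ↔ (∀ w : WeilGroup F, f ∘ₗ τ.ρ w = σ.ρ w ∘ₗ f) ∧ f ∘ₗ τ.N = σ.N ∘ₗ f :=
  Iff.rfl

/-- **`Hom_WD(τ, σ)` with values in a subspace `U ≤ V`** (for `U` a sub-Weil–Deligne representation this
is `Hom_WD(τ, σ|_U)`, kept inside `W →ₗ V` to avoid subtypes). [cite: Deligne1973Constantes, 8.5–8.6] -/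
def homWDIn (τ : WeilDeligneRep F ℂ W) (σ : WeilDeligneRep F ℂ V) (U : Submodule ℂ V) :
    Submodule ℂ (W →ₗ[ℂ] V) where
  carrier := {f | f ∈ homWD τ σ ∧ ∀ x, f x ∈ U}
  add_mem' := by
    rintro f g ⟨hf, hfU⟩ ⟨hg, hgU⟩
    exact ⟨Submodule.add_mem _ hf hg, fun x => Submodule.add_mem _ (hfU x) (hgU x)⟩
  zero_mem' := ⟨Submodule.zero_mem _, fun x => Submodule.zero_mem _⟩
  smul_mem' := by
    rintro c f ⟨hf, hfU⟩
    exact ⟨Submodule.smul_mem _ c hf, fun x => Submodule.smul_mem _ c (hfU x)⟩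

/-- Membership in `Hom_WD(τ, σ; U)`. [cite: Deligne1973Constantes, 8.5–8.6] -/
theorem mem_homWDIn_iff {τ : WeilDeligneRep F ℂ W} {σ : WeilDeligneRep F ℂ V} {U : Submodule ℂ V}
    {f : W →ₗ[ℂ] V} : f ∈ homWDIn τ σ U ↔ f ∈ homWD τ σ ∧ ∀ x, f x ∈ U :=
  Iff.rfl

end Hom

/-! ## Unramified twists -/

section Twist

variable {H : Type*} [AddCommGroup H] [Module ℂ H] {H' : Type*} [AddCommGroup H'] [Module ℂ H']

/-- `deg` is a homomorphism (the named facts `IsFrobPow.mul`, `IsFrobPow.unique` are DISCHARGED in the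
tree). [cite: TateCorvallis1979, (1.4.1)] -/
theorem deg_mul' (w w' : WeilGroup F) : deg (w * w') = deg w + deg w' :=
  deg_mul IsFrobPow.mul_holds IsFrobPow.unique_holds w w'

/-- `deg 1 = 0`. [cite: TateCorvallis1979, (1.4.1)] -/
theorem deg_one' : deg (1 : WeilGroup F) = 0 :=
  deg_one IsFrobPow.mul_holds IsFrobPow.unique_holds

/-- The **unramified twist** `ρ ⊗ ‖·‖^b`: `w ↦ (q^{deg w})^b • ρ(w)`. [cite: TateCorvallis1979, (4.1.4)] -/
def twistRep (ρ : Representation ℂ (WeilGroup F) H) (b : ℤ) : Representation ℂ (WeilGroup F) H where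
  toFun w := (((residueFieldCard F : ℂ) ^ (deg w)) ^ b) • ρ w
  map_one' := by rw [deg_one', zpow_zero, one_zpow, one_smul, map_one]
  map_mul' w w' := by
    rw [deg_mul', zpow_add₀ (by exact_mod_cast residueFieldCard_ne_zero F), mul_zpow, map_mul,
      smul_mul_smul_comm]

/-- Unfolding of the twist. [cite: TateCorvallis1979, (4.1.4)] -/
theorem twistRep_apply (ρ : Representation ℂ (WeilGroup F) H) (b : ℤ) (w : WeilGroup F) (x : H) :
    twistRep ρ b w x = (((residueFieldCard F : ℂ) ^ (deg w)) ^ b) • ρ w x := rfl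

/-- **`ρ ⊗ ‖·‖^b ≅ ρ'`** as representations of `W_F` (Mathlib `Representation.Equiv`).
[cite: TateCorvallis1979, (4.1.4)] -/
def IsoTw (ρ : Representation ℂ (WeilGroup F) H) (b : ℤ) (ρ' : Representation ℂ (WeilGroup F) H') : Prop :=
  Nonempty ((twistRep ρ b).Equiv ρ')

end Twist

/-! ## The standard string `ρ ⊗ Sp(d)` -/

section Model

variable {H : Type*} [AddCommGroup H] [Module ℂ H]

/-- The shift `(y_0, …, y_{d-1}) ↦ (0, y_0, …, y_{d-2})` on `Fin d → H`. [folklore] -/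
def shiftMap (H : Type*) [AddCommGroup H] [Module ℂ H] (d : ℕ) : (Fin d → H) →ₗ[ℂ] (Fin d → H) where
  toFun y j := if h : (j : ℕ) = 0 then 0 else y ⟨(j : ℕ) - 1, by omega⟩
  map_add' y z := by funext j; by_cases h : (j : ℕ) = 0 <;> simp [h]
  map_smul' c y := by funext j; by_cases h : (j : ℕ) = 0 <;> simp [h]

/-- Unfolding of the shift. [folklore] -/
theorem shiftMap_apply (d : ℕ) (y : Fin d → H) (j : Fin d) :
    shiftMap H d y j = if h : (j : ℕ) = 0 then 0 else y ⟨(j : ℕ) - 1, by omega⟩ := rfl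

/-- Powers of the shift: `(shift^k y)_j = y_{j-k}` for `k ≤ j` and `0` otherwise. [folklore] -/
theorem shiftMap_pow_apply (d k : ℕ) (y : Fin d → H) (j : Fin d) :
    (shiftMap H d ^ k) y j = if h : k ≤ (j : ℕ) then y ⟨(j : ℕ) - k, by omega⟩ else 0 := by
  induction k generalizing j with
  | zero => simp
  | succ k ih =>
    rw [pow_succ', Module.End.mul_apply, shiftMap_apply]
    by_cases hj : (j : ℕ) = 0
    · rw [dif_pos hj, dif_neg (by omega)]
    · rw [dif_neg hj, ih]
      by_cases hk : k ≤ (j : ℕ) - 1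
      · rw [dif_pos hk, dif_pos (by omega)]
        congr 1
        exact Fin.ext (by dsimp only; omega)
      · rw [dif_neg hk, dif_neg (by omega)]

/-- The shift on `Fin d → H` is nilpotent of index `≤ d`. [folklore] -/
theorem shiftMap_pow_eq_zero (d : ℕ) : shiftMap H d ^ d = 0 := by
  refine LinearMap.ext fun y => funext fun j => ?_
  rw [shiftMap_pow_apply, dif_neg (by omega), LinearMap.zero_apply, Pi.zero_apply]

/-- The slot-wise twisted action `(y_j) ↦ ((q^{deg w})^j ρ(w) y_j)` of `w ∈ W_F` on `Fin d → H`.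
[cite: TateCorvallis1979, (4.1.4)] -/
def stringModelAct (ρ : Representation ℂ (WeilGroup F) H) (d : ℕ) (w : WeilGroup F) :
    (Fin d → H) →ₗ[ℂ] (Fin d → H) where
  toFun y j := (((residueFieldCard F : ℂ) ^ (deg w)) ^ (j : ℕ)) • ρ w (y j)
  map_add' y z := by funext j; simp
  map_smul' c y := by funext j; simp [smul_comm c]

/-- Unfolding of the slot-wise action. [cite: TateCorvallis1979, (4.1.4)] -/
theorem stringModelAct_apply (ρ : Representation ℂ (WeilGroup F) H) (d : ℕ) (w : WeilGroup F)
    (y : Fin d → H) (j : Fin d) :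
    stringModelAct ρ d w y j = (((residueFieldCard F : ℂ) ^ (deg w)) ^ (j : ℕ)) • ρ w (y j) := rfl

/-- The slot-wise twisted action is a representation of `W_F`. [cite: TateCorvallis1979, (4.1.4)] -/
def stringModelRep (ρ : Representation ℂ (WeilGroup F) H) (d : ℕ) :
    Representation ℂ (WeilGroup F) (Fin d → H) where
  toFun := stringModelAct ρ d
  map_one' := by
    refine LinearMap.ext fun y => funext fun j => ?_
    simp [stringModelAct_apply, deg_one']
  map_mul' w w' := by
    refine LinearMap.ext fun y => funext fun j => ?_
    simp only [stringModelAct_apply, Module.End.mul_apply, map_mul, map_smul, deg_mul',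
      zpow_add₀ (show (residueFieldCard F : ℂ) ≠ 0 by exact_mod_cast residueFieldCard_ne_zero F),
      mul_pow, mul_smul]

/-- Unfolding of the representation of the standard string. [cite: TateCorvallis1979, (4.1.4)] -/
theorem stringModelRep_apply (ρ : Representation ℂ (WeilGroup F) H) (d : ℕ) (w : WeilGroup F)
    (y : Fin d → H) (j : Fin d) :
    stringModelRep ρ d w y j = (((residueFieldCard F : ℂ) ^ (deg w)) ^ (j : ℕ)) • ρ w (y j) := rfl

/-- **The standard string `ρ ⊗ Sp(d)`** on `Fin d → H`: slot `j` carries `ρ ⊗ ‖·‖^j` and the monodromy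
is the shift `y_j ↦ y_{j-1}` (so `ρ(w) N ρ(w)⁻¹ = q^{deg w} N`, the tree's convention).  Continuity from
that of `ρ` (`deg = 0` on inertia). [cite: TateCorvallis1979, (4.1.4)–(4.1.5)] -/
def stringModel (ρ : Representation ℂ (WeilGroup F) H) (hρ : WeilGroup.IsContinuousRep ρ) (d : ℕ) :
    WeilDeligneRep F ℂ (Fin d → H) where
  ρ := stringModelRep ρ d
  isContinuous := by
    obtain ⟨U, hU, hUo, hρU⟩ := hρ
    refine ⟨U, hU, hUo, fun u hu => LinearMap.ext fun y => funext fun j => ?_⟩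
    simp [stringModelRep_apply, hρU u hu, WeilDeligneRep.deg_eq_zero_of_mem_inertia (hU hu)]
  N := shiftMap H d
  isNilpotent_N := ⟨d, shiftMap_pow_eq_zero d⟩
  conj_N w := by
    refine LinearMap.ext fun y => funext fun j => ?_
    simp only [LinearMap.coe_comp, Function.comp_apply, LinearMap.smul_apply, Pi.smul_apply,
      shiftMap_apply, stringModelRep_apply]
    split_ifs with hj
    · simp
    · rw [smul_smul]
      congr 1
      have : (j : ℕ) = ((j : ℕ) - 1) + 1 := by omega
      conv_lhs => rw [this, pow_succ]
      ring

/-- The representation of the standard string. [cite: TateCorvallis1979, (4.1.4)] -/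
@[simp] theorem stringModel_ρ (ρ : Representation ℂ (WeilGroup F) H) (hρ : WeilGroup.IsContinuousRep ρ)
    (d : ℕ) : (stringModel ρ hρ d).ρ = stringModelRep ρ d := rfl

/-- The monodromy of the standard string is the shift. [cite: TateCorvallis1979, (4.1.5)] -/
@[simp] theorem stringModel_N (ρ : Representation ℂ (WeilGroup F) H) (hρ : WeilGroup.IsContinuousRep ρ)
    (d : ℕ) : (stringModel ρ hρ d).N = shiftMap H d := rfl

end Model

/-! ## Twisted commutation of `ρ(w)` and `N^j`; strings are sub-Weil–Deligne representations -/

section StringBasics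

variable {V : Type*} [AddCommGroup V] [Module ℂ V]

/-- `ρ(w) ∘ N^j = q^{j·deg w} • N^j ∘ ρ(w)` (iterate the Weil–Deligne relation).
[cite: TateCorvallis1979, (4.1.2)] -/
theorem ρ_comp_pow_N (r : WeilDeligneRep F ℂ V) (w : WeilGroup F) (j : ℕ) :
    r.ρ w ∘ₗ (r.N ^ j) = ((residueFieldCard F : ℂ) ^ (deg w)) ^ j • ((r.N ^ j) ∘ₗ r.ρ w) := by
  induction j with
  | zero => simp [Module.End.one_eq_id]
  | succ j ih =>
    rw [pow_succ, Module.End.mul_eq_comp, ← LinearMap.comp_assoc, ih, LinearMap.smul_comp,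
      LinearMap.comp_assoc, r.conj_N w, LinearMap.comp_smul, ← LinearMap.comp_assoc, smul_smul,
      pow_succ]

/-- Pointwise form: `ρ(w) (N^j v) = q^{j·deg w} • N^j (ρ(w) v)`. [cite: TateCorvallis1979, (4.1.2)] -/
theorem ρ_pow_N_apply (r : WeilDeligneRep F ℂ V) (w : WeilGroup F) (j : ℕ) (v : V) :
    r.ρ w ((r.N ^ j) v) = ((residueFieldCard F : ℂ) ^ (deg w)) ^ j • (r.N ^ j) (r.ρ w v) :=
  congr($(ρ_comp_pow_N r w j) v)

/-- The scalar `q^{j·deg w}` is non-zero. [folklore] -/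
theorem qpow_ne_zero (w : WeilGroup F) (j : ℕ) : (((residueFieldCard F : ℂ) ^ (deg w)) ^ j) ≠ 0 :=
  pow_ne_zero _ (WeilDeligneRep.residueFieldCard_zpow_ne_zero (deg w))

/-- `N^j (ρ(w) v) = q^{-j·deg w} • ρ(w) (N^j v)`. [cite: TateCorvallis1979, (4.1.2)] -/
theorem pow_N_ρ_apply (r : WeilDeligneRep F ℂ V) (w : WeilGroup F) (j : ℕ) (v : V) :
    (r.N ^ j) (r.ρ w v) = (((residueFieldCard F : ℂ) ^ (deg w)) ^ j)⁻¹ • r.ρ w ((r.N ^ j) v) := by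
  rw [ρ_pow_N_apply, smul_smul, inv_mul_cancel₀ (qpow_ne_zero w j), one_smul]

variable (r : WeilDeligneRep F ℂ V)

/-- String sums with entries in the head lie in the string. [cite: TateCorvallis1979, (4.1.5)] -/
theorem strMap_mem_stringSpan {H : Submodule ℂ V} {d : ℕ} {y : Fin d → V} (hy : ∀ j, y j ∈ H) :
    strMap r d y ∈ stringSpan r H d :=
  (mem_stringSpan_iff r).mpr ⟨y, hy, rfl⟩

/-- `Σ_{j ≤ d} N^j y_j = y_0 + Σ_{j<d} N^j (N y_{j+1})`. [folklore] -/
theorem strMap_succ (d : ℕ) (y : Fin (d + 1) → V) :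
    strMap r (d + 1) y = y 0 + strMap r d (fun j => r.N (y j.succ)) := by
  rw [strMap_apply, strMap_apply, Fin.sum_univ_succ]
  simp only [Fin.val_zero, pow_zero, Module.End.one_apply, Fin.val_succ, pow_succ,
    Module.End.mul_apply]

/-- `ρ(w)` acts on a string sum through the head: `ρ(w) Σ N^j y_j = Σ N^j (q^{j deg w} ρ(w) y_j)`.
[cite: TateCorvallis1979, (4.1.2)] -/
theorem ρ_strMap (d : ℕ) (w : WeilGroup F) (y : Fin d → V) :
    r.ρ w (strMap r d y) =
      strMap r d (fun j => (((residueFieldCard F : ℂ) ^ (deg w)) ^ (j : ℕ)) • r.ρ w (y j)) := by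
  simp only [strMap_apply, map_sum, ρ_pow_N_apply, map_smul]

/-- `N Σ_{j<d} N^j y_j = Σ_{j<d} N^j y'_j` with `y' = (0, y_0, …, y_{d-2})`, provided `N^d y_{d-1} = 0`.
[folklore] -/
theorem N_strMap_succ (d : ℕ) (y : Fin (d + 1) → V) (hy : (r.N ^ (d + 1)) (y (Fin.last d)) = 0) :
    r.N (strMap r (d + 1) y) = strMap r (d + 1) (Fin.cons 0 (fun j : Fin d => y j.castSucc)) := by
  rw [strMap_apply, strMap_apply, map_sum, Fin.sum_univ_castSucc, Fin.sum_univ_succ]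
  simp only [Fin.cons_zero, map_zero, zero_add, Fin.cons_succ, Fin.val_succ, Fin.val_last,
    Fin.val_castSucc, pow_succ', Module.End.mul_apply]
  rw [← Module.End.mul_apply (f := r.N), ← pow_succ', hy, add_zero]

variable {r}

/-- The string over a `W_F`-stable head is `W_F`-stable. [cite: TateCorvallis1979, (4.1.5)] -/
theorem IsWStable.stringSpan {H : Submodule ℂ V} (hH : IsWStable r H) (d : ℕ) :
    IsWStable r (stringSpan r H d) := by
  intro w x hx
  obtain ⟨y, hy, rfl⟩ := (mem_stringSpan_iff r).mp hx
  rw [Submodule.mem_comap, ρ_strMap]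
  exact strMap_mem_stringSpan r fun j => Submodule.smul_mem _ _ (hH w (hy j))

/-- The string is `N`-stable when `N^d H = 0`; with a `W_F`-stable head it is a sub-Weil–Deligne
representation. [cite: TateCorvallis1979, (4.1.5)] -/
theorem isSubrep_stringSpan {H : Submodule ℂ V} (hH : IsWStable r H) {d : ℕ}
    (hd : H ≤ LinearMap.ker (r.N ^ d)) : r.IsSubrep (stringSpan r H d) := by
  refine ⟨hH.stringSpan d, fun x hx => ?_⟩
  obtain ⟨y, hy, rfl⟩ := (mem_stringSpan_iff r).mp hx
  rw [Submodule.mem_comap]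
  cases d with
  | zero => rw [strMap_apply]; simp
  | succ d =>
    rw [N_strMap_succ r d y (hd (hy (Fin.last d)))]
    refine strMap_mem_stringSpan r fun j => ?_
    refine Fin.cases ?_ (fun i => ?_) j
    · simp
    · simpa using hy i.castSucc

end StringBasics

/-- **Registered sub-goal `stub_isSubrep_stringSpan`**: the string `H + N H + ⋯ + N^{d-1} H` over a
`W_F`-stable head killed by `N^d` is a sub-Weil–Deligne representation (`W_F`-stable by the twisted
commutation `ρ(w) N^j = q^{j deg w} N^j ρ(w)`, `N`-stable by `N^d H = 0`). [cite: TateCorvallis1979, (4.1.5)] -/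
theorem stub_isSubrep_stringSpan : ∀ (F : Type) [Field F] [ValuativeRel F] [TopologicalSpace F] [IsNonarchimedeanLocalField F] (V : Type) [AddCommGroup V] [Module ℂ V] (r : WeilDeligneRep F ℂ V) (H : Submodule ℂ V) (d : ℕ), IsWStable r H → H ≤ LinearMap.ker (r.N ^ d) → r.IsSubrep (stringSpan r H d) :=
  fun _ _ _ _ _ _ _ _ _ _ _ hH hd => isSubrep_stringSpan hH hd

section HeadHom
variable {H : Type*} [AddCommGroup H] [Module ℂ H] {V : Type*} [AddCommGroup V] [Module ℂ V]
/-- **The head space `Hom_W(ρ, σ; N^d = 0, U)`** (appended by lead c2): `W_F`-equivariant `g : (H, ρ) → (V, σ)`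
killed by `N^d` with values in `U`; for the standard string, restriction to slot `0` identifies
`Hom_WD(ρ ⊗ Sp(d), σ; U)` with it (a morphism out of a string is determined by its head). [cite: HenniartBSMF2002, §4] -/
def headHom (ρ : Representation ℂ (WeilGroup F) H) (σ : WeilDeligneRep F ℂ V) (d : ℕ)
    (U : Submodule ℂ V) : Submodule ℂ (H →ₗ[ℂ] V) where
  carrier := {g | (∀ w : WeilGroup F, g ∘ₗ ρ w = σ.ρ w ∘ₗ g) ∧ (σ.N ^ d) ∘ₗ g = 0 ∧ ∀ x, g x ∈ U}
  add_mem' := by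
    rintro f g ⟨hf, hfN, hfU⟩ ⟨hg, hgN, hgU⟩
    exact ⟨fun w => by rw [LinearMap.add_comp, LinearMap.comp_add, hf, hg],
      by rw [LinearMap.comp_add, hfN, hgN, add_zero], fun x => Submodule.add_mem _ (hfU x) (hgU x)⟩
  zero_mem' := ⟨fun w => by simp, by rw [LinearMap.comp_zero], fun x => Submodule.zero_mem _⟩
  smul_mem' := by
    rintro c f ⟨hf, hfN, hfU⟩
    exact ⟨fun w => by rw [LinearMap.smul_comp, LinearMap.comp_smul, hf],
      by rw [LinearMap.comp_smul, hfN, smul_zero], fun x => Submodule.smul_mem _ c (hfU x)⟩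
/-- **Registered sub-goal `stub_mem_headHom_iff`**: membership in the head space (definitional).
[cite: HenniartBSMF2002, §4] -/
theorem stub_mem_headHom_iff : ∀ (F : Type) [Field F] [ValuativeRel F] [TopologicalSpace F] [IsNonarchimedeanLocalField F] (H : Type) [AddCommGroup H] [Module ℂ H] (V : Type) [AddCommGroup V] [Module ℂ V] (ρ : Representation ℂ (WeilGroup F) H) (σ : WeilDeligneRep F ℂ V) (d : ℕ) (U : Submodule ℂ V) (g : H →ₗ[ℂ] V), g ∈ headHom ρ σ d U ↔ ((∀ w : WeilGroup F, g ∘ₗ ρ w = σ.ρ w ∘ₗ g) ∧ (σ.N ^ d) ∘ₗ g = 0 ∧ ∀ x, g x ∈ U) :=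
  fun _ _ _ _ _ _ _ _ _ _ _ _ _ _ _ _ => Iff.rfl
end HeadHom
end Summit.Langlands.Langlands.Theorems.ReciprocityUpToIrreducibilityR

end
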